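import Literature.AlgebraicGeometry.Motives.TateAbelianFiniteProofs
import Literature.AlgebraicGeometry.Motives.TateAbelianFiniteStepsProofs
import Literature.NumberTheory.DiophantineGeometry.AVGaloisModuleContinuityProofs
import Literature.NumberTheory.DiophantineGeometry.AVIsogenyTateRationalEquivProofs
import Literature.NumberTheory.EllipticCurves.TateModuleProjSurjectiveProofs
import HarnessLib

/-!
# Tate 1966, Main Theorem: assembly from the open named facts, and the saturation step

Sibling (theorems only) of `Literature.AlgebraicGeometry.Motives.TateAbelianFiniteProofs`, whose
assembly `tate_bijective_of_finite_of_facts A B ℓ` derives the named fact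
`Literature.AlgebraicGeometry.Motives.tate_bijective_of_finite A B ℓ` (J. Tate, *Endomorphisms of
abelian varieties over finite fields*, Invent. Math. 2 (1966), Main Theorem: for `K` finite and
`ℓ ≠ char K` the Tate map `ℤ_ℓ ⊗ Hom_K(A, B) → Hom_{Γ_K}(T_ℓ A, T_ℓ B)` is bijective) from eight
inputs. This file removes four of them.

1. **Three inputs are now theorems of the tree** and are fed in
   (`tate_bijective_of_finite_of_open_facts`, `…_bicone`): products of abelian varieties,
   `AbelianVariety.hasBinaryBiproduct_holds A B` (`TateAbelianFiniteStepsProofs`, from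
   `AbelianVarietyProduct`); `T_ℓ P` free over `ℤ_ℓ`, `AbelianVariety.module_free_tateModule_holds`,
   and finitely generated for `ℓ ≠ char K`, `AbelianVariety.module_finite_tateModule_of_cast_ne_zero`
   (`AVGaloisModuleContinuityProofs`: `[ℓ]_P` is étale, hence an isogeny, so `P[ℓ](K̄)` is finite).
2. **The saturation input is reduced to divisibility by `ℓ` in `Hom_K(A, B)`** — Tate 1966, §1,
   Lemma 1 / Milne 1986, Thm. 12.5 (torsion-free cokernel of
   `ℤ_ℓ ⊗ Hom_K(A, B) → Hom_{ℤ_ℓ}(T_ℓ A, T_ℓ B)`) as derived in Kieffer 2024, proof of Prop. 1.2.21: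
   * `exists_proj_one_eq_of_cast_ne_zero`: for `ℓ ≠ char K`, `T_ℓ A → A[ℓ](K̄)` is onto — `[ℓ]_A`
     is an isogeny (`isIsogeny_zsmul_id_of_cast_ne_zero`, `AbelianVarietyLie`), hence onto `A(K̄)`
     (`IsIsogeny.geomPointsMap_surjective`, `AVIsogenyTateRationalEquivProofs`), and an
     `ℓ`-divisible group has surjective projections from its Tate module
     (`TateModule.exists_proj_eq_of_smul_surjective`, `TateModuleProjSurjectiveProofs`);
   * `mem_span_of_smul_mem_span_of_divisible`: if every `φ : A → B` killing `A[ℓ](K̄)` is `ℓ ψ`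
     (`hdiv`), then `ℓ s ∈ ℤ_ℓ · {T_ℓ f} ⇒ s ∈ ℤ_ℓ · {T_ℓ f}`: write `ℓ s = Σ cᵢ T_ℓ fᵢ`,
     `cᵢ = nᵢ + ℓ cᵢ'` with `nᵢ ∈ ℕ` (`PadicInt.zmodRepr`), so that `φ = Σ nᵢ fᵢ` has
     `T_ℓ φ = ℓ (s − Σ cᵢ' T_ℓ fᵢ)`; then `φ` kills `A[ℓ](K̄)` (evaluate at a lift to `T_ℓ A`),
     `φ = ℓ ψ`, and `s = T_ℓ ψ + Σ cᵢ' T_ℓ fᵢ` because `T_ℓ B` is torsion-free ("approximating the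
     coefficients `λᵢ` by integers … `A[ℓ] ⊆ ker(φₙ)` … by isogeny factorization `φₙ = ℓ ψₙ`",
     Kieffer p. 29);
   * `mem_span_of_smul_mem_span_of_forall`: `ℓ`-saturation gives saturation for every
     `d = u ℓᵐ ≠ 0` (`PadicInt.unitCoeff_spec`); `saturated_span_tateModuleMap_of_divisible`.
3. **Assembly, divisibility form** (`tate_bijective_of_finite_of_open_facts_of_divisible`): the named
   fact `tate_bijective_of_finite A B ℓ` follows from the named facts
   `AbelianVariety.faltingsTateMap_injective A B` (Mumford §19 Thm. 3),
   `AbelianVariety.finite_isoClasses_of_finite K g` (Milne 1986 Cor. 18.9),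
   `AbelianVariety.exists_quotient_isogeny P ℓ` (Kieffer Prop. 1.1.10–1.1.13) — none of which has a
   discharge — and two printed theorems that are not yet named facts of the tree: the
   semisimplicity of `E_ℓ(P) ≅ ℚ_ℓ ⊗ End_K(P)` (Mumford §19, Cor. 2 of Thm. 1, p. 174, Poincaré's
   complete reducibility; Kieffer Cor. 1.2.9) and the divisibility `hdiv` (isogeny factorisation
   through the separable isogeny `[ℓ]_A`: Kieffer Prop. 1.1.12; Mumford §7 Thm. 4), equivalently
   the universal property of `[ℓ]_A : A → A` as the quotient by `A[ℓ]` on `K̄`-points — the tree has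
   the scheme-theoretic version `IsIsogeny.exists_comp_eq_of_kerPoints_le_holds` (`AVIsogenyFlat`),
   from which `hdiv` follows once `Ker [ℓ]_A` is known to be reduced (étale: `etale_zsmul_id_holds`).

No named fact is introduced and no `_holds` is asserted (D-0026).

## References

* [Tate1966Endomorphisms] J. Tate, *Endomorphisms of abelian varieties over finite fields*,
  Invent. Math. 2 (1966), 134–144, Main Theorem and §1 Lemma 1. Not held.
* [Kieffer2024IsogenyGraphs] J. Kieffer, *Isogeny graphs of abelian varieties over finite fields*
  (2024), Prop. 1.1.12 (p. 11), §1.2.4: Prop. 1.2.20–1.2.26 (pp. 28–32), esp. proof of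
  Prop. 1.2.21 (p. 29); held (`paper:galaxy-pdf-6943401066381083540`), read.
* [Milne1986AbelianVarieties] J. S. Milne, *Abelian Varieties*, in Cornell–Silverman (1986),
  Thm. 12.5, Cor. 18.9; held.
* [MumfordAV1970] D. Mumford, *Abelian Varieties*, §7 Thm. 4; §19 (Thm. 3; Cor. 2 of Thm. 1,
  p. 174; p. 171). Not held.

## Design

Theorems only; `noncomputable section`; universe-monomorphic `K : Type u`. The `ℤ_ℓ`-span of the
`T_ℓ f` is written out (`Submodule.span ℤ_[ℓ] (Set.range (tateModuleMap ℓ))`) rather than named,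
to avoid a `Prop`- or data-level definition; `T_ℓ` is pushed through finite sums with a local
additive-map packaging (`exists_addMonoidHom_tateModuleMap`). The generic Tate-module lemma
`TateModule.exists_proj_eq_of_smul_surjective` lives in an elliptic-curve proof file
(`TateModuleProjSurjectiveProofs`), which is therefore imported (reused, not restated).
-/

noncomputable section

universe u

open CategoryTheory CategoryTheory.Limits

namespace Literature.AlgebraicGeometry.Motives

open AbelianVariety

variable {K : Type u} [Field K] (A B : AbelianVariety K) (ℓ : ℕ) [Fact ℓ.Prime]

/-- **Tate's Main Theorem from the open named facts** (Tate, Invent. Math. 2 (1966), Main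
Theorem; architecture Kieffer 2024, §1.2.4). `tate_bijective_of_finite A B ℓ` — bijectivity of
`ℤ_ℓ ⊗ Hom_K(A, B) → Hom_{Γ_K}(T_ℓ A, T_ℓ B)` for `K` finite, `(ℓ : K) ≠ 0` — follows from:
`hinj`, injectivity of the Tate map (named fact `faltingsTateMap_injective A B`, Mumford §19
Thm. 3); `hfin`, finiteness of `K`-isomorphism classes of abelian varieties of each dimension over
the finite field `K` (named fact `finite_isoClasses_of_finite K g`, Milne 1986 Cor. 18.9); `hq`,
quotients by finite `Γ_K`-stable `ℓ`-power subgroups (named fact `exists_quotient_isogeny P ℓ`);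
`hss`, semisimplicity of the `ℚ_ℓ`-algebra `E_ℓ(P)` spanned by the `V_ℓ φ`, `φ ∈ End_K(P)`
(Poincaré reducibility, Mumford §19 Cor. 2 of Thm. 1); `hsat`, saturation of the `ℤ_ℓ`-span of the
`T_ℓ f` in `Hom_{ℤ_ℓ}(T_ℓ A, T_ℓ B)` (torsion-free cokernel, Tate 1966 §1 Lemma 1, Milne 1986
Thm. 12.5). Products (`hasBinaryBiproduct_holds`), freeness (`module_free_tateModule_holds`) and
finite generation for `ℓ ≠ char K` (`module_finite_tateModule_of_cast_ne_zero`) of `T_ℓ(A × B)`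
are theorems of the tree and are supplied here; the rest is `tate_bijective_of_finite_of_facts`'s
proof (lattice lemma, double centraliser, clearing denominators, saturation).
[cite: Tate1966Endomorphisms, Main Theorem] -/
theorem tate_bijective_of_finite_of_open_facts (hinj : faltingsTateMap_injective A B)
    (hfin : ∀ g : ℕ, finite_isoClasses_of_finite K g)
    (hq : ∀ P : AbelianVariety K, exists_quotient_isogeny P ℓ)
    (hss : ∀ P : AbelianVariety K, IsSemisimpleRing (rationalEndSubalgebra P ℓ))
    (hsat : (ℓ : K) ≠ 0 → ∀ (t : A.tateModule ℓ →ₗ[ℤ_[ℓ]] B.tateModule ℓ) (d : ℤ_[ℓ]), d ≠ 0 →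
      d • t ∈ Submodule.span ℤ_[ℓ] (Set.range (tateModuleMap ℓ : (A ⟶ B) → _)) →
      t ∈ Submodule.span ℤ_[ℓ] (Set.range (tateModuleMap ℓ : (A ⟶ B) → _))) :
    tate_bijective_of_finite A B ℓ := by
  refine tate_bijective_of_finite_of_injective_of_surjective A B ℓ hinj fun hℓ ↦ ?_
  obtain ⟨b, -⟩ := exists_binaryBicone_total_holds A B
  exact faltingsTateMap_surjective_of_finite ℓ hℓ b (hfin _) (hq _)
    (module_free_tateModule_holds b.pt ℓ) (module_finite_tateModule_of_cast_ne_zero b.pt ℓ hℓ)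
    (hss _) (hsat hℓ)

/-- The same with the product-level inputs stated for the product only: for a bicone `b` on
`(A, B)` it suffices to know `finite_isoClasses_of_finite K (dim b.pt)`,
`exists_quotient_isogeny b.pt ℓ` and the semisimplicity of `E_ℓ(b.pt)` (with `hinj`, `hsat` as
above). [cite: Tate1966Endomorphisms, Main Theorem] -/
theorem tate_bijective_of_finite_of_open_facts_bicone (b : BinaryBicone A B)
    (hinj : faltingsTateMap_injective A B) (hfin : finite_isoClasses_of_finite K b.pt.dim)
    (hq : exists_quotient_isogeny b.pt ℓ) (hss : IsSemisimpleRing (rationalEndSubalgebra b.pt ℓ))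
    (hsat : (ℓ : K) ≠ 0 → ∀ (t : A.tateModule ℓ →ₗ[ℤ_[ℓ]] B.tateModule ℓ) (d : ℤ_[ℓ]), d ≠ 0 →
      d • t ∈ Submodule.span ℤ_[ℓ] (Set.range (tateModuleMap ℓ : (A ⟶ B) → _)) →
      t ∈ Submodule.span ℤ_[ℓ] (Set.range (tateModuleMap ℓ : (A ⟶ B) → _))) :
    tate_bijective_of_finite A B ℓ :=
  tate_bijective_of_finite_of_injective_of_surjective A B ℓ hinj fun hℓ ↦
    faltingsTateMap_surjective_of_finite ℓ hℓ b hfin hq (module_free_tateModule_holds b.pt ℓ)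
      (module_finite_tateModule_of_cast_ne_zero b.pt ℓ hℓ) hss (hsat hℓ)

/-! ## The saturation hypothesis from divisibility by `ℓ` in `Hom_K(A, B)` -/

section Saturation

open Literature.NumberTheory.EllipticCurves

variable {A B}

/-- `f ↦ T_ℓ f` as an additive homomorphism `Hom_K(A, B) →+ Hom_{ℤ_ℓ}(T_ℓ A, T_ℓ B)`
(`tateModuleMap_zero`, `tateModuleMap_add`), to push `T_ℓ` through finite sums. [folklore] -/
theorem exists_addMonoidHom_tateModuleMap :
    ∃ T : (A ⟶ B) →+ (A.tateModule ℓ →ₗ[ℤ_[ℓ]] B.tateModule ℓ), ∀ f, T f = tateModuleMap ℓ f :=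
  ⟨{ toFun := tateModuleMap ℓ, map_zero' := tateModuleMap_zero ℓ, map_add' := tateModuleMap_add ℓ },
    fun _ ↦ rfl⟩

omit [Fact ℓ.Prime] in
/-- **Level-one lifting**: for `ℓ ≠ char K`, every `x ∈ A[ℓ](K̄)` is the first component of an
element of `T_ℓ A` — `[ℓ]_A` is an isogeny (`isIsogeny_zsmul_id_of_cast_ne_zero`, `[ℓ]` étale),
hence onto `A(K̄)` (`IsIsogeny.geomPointsMap_surjective`), so `A(K̄)` is `ℓ`-divisible and
compatible sequences through `x` exist (`TateModule.exists_proj_eq_of_smul_surjective`).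
Mumford, *Abelian Varieties*, §19, p. 171 (`T_ℓ A → A[ℓⁿ]` onto). [cite: MumfordAV1970, §19 p. 171] -/
theorem exists_proj_one_eq_of_cast_ne_zero (hℓ : (ℓ : K) ≠ 0) (x : A.geomPoints)
    (hx : ℓ • x = 0) : ∃ a : A.tateModule ℓ, TateModule.proj ℓ 1 a = x := by
  have hiso : IsIsogeny ((ℓ : ℤ) • 𝟙 A) :=
    isIsogeny_zsmul_id_of_cast_ne_zero (A := A) (ℓ : ℤ) (by exact_mod_cast hℓ)
  have hs : Function.Surjective fun P : A.geomPoints ↦ ℓ • P := by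
    intro y
    obtain ⟨P, hP⟩ := hiso.geomPointsMap_surjective y
    refine ⟨P, ?_⟩
    show ℓ • P = y
    rw [← hP, natCast_zsmul, geomPointsMap_nsmul_apply, Hom.geomPointsMap_id, AddMonoidHom.id_apply]
  exact TateModule.exists_proj_eq_of_smul_surjective hs 1
    (AddSubgroup.torsionBy.nsmul_iff.mpr (by rwa [pow_one]))

/-- **`ℓ`-saturation of `ℤ_ℓ · T_ℓ(Hom_K(A, B))` from divisibility by `ℓ` in `Hom_K(A, B)`**
(Tate 1966, §1, Lemma 1; Kieffer 2024, proof of Prop. 1.2.21: "approximating the coefficients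
`λ_i` by integers … `A[ℓ] ⊆ ker(φ_n)`; by isogeny factorization we can write `φ_n = ℓ ψ_n`").
Assume (`hproj`) every `x ∈ A[ℓ](K̄)` lifts to `T_ℓ A` and (`hdiv`) every homomorphism
`φ : A → B` killing `A[ℓ](K̄)` is `ℓ ψ` for some `ψ : A → B`. If `ℓ • s = Σ cᵢ T_ℓ fᵢ` with
`cᵢ ∈ ℤ_ℓ`, write `cᵢ = nᵢ + ℓ cᵢ'` with `nᵢ ∈ ℕ` (`PadicInt.zmodRepr`); then
`φ = Σ nᵢ fᵢ` has `T_ℓ φ = ℓ (s − Σ cᵢ' T_ℓ fᵢ)`, so `φ` kills `A[ℓ](K̄)` (evaluate at a lift),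
`φ = ℓ ψ`, and `s = T_ℓ ψ + Σ cᵢ' T_ℓ fᵢ` (`T_ℓ B` is torsion-free).
[cite: Kieffer2024IsogenyGraphs, Prop. 1.2.21] -/
theorem mem_span_of_smul_mem_span_of_divisible
    (hproj : ∀ x : A.geomPoints, ℓ • x = 0 → ∃ a : A.tateModule ℓ, TateModule.proj ℓ 1 a = x)
    (hdiv : ∀ φ : A ⟶ B, (∀ x : A.geomPoints, ℓ • x = 0 → Hom.geomPointsMap φ x = 0) →
      ∃ ψ : A ⟶ B, φ = ℓ • ψ)
    {s : A.tateModule ℓ →ₗ[ℤ_[ℓ]] B.tateModule ℓ}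
    (hs : (ℓ : ℤ_[ℓ]) • s ∈ Submodule.span ℤ_[ℓ] (Set.range (tateModuleMap ℓ : (A ⟶ B) → _))) :
    s ∈ Submodule.span ℤ_[ℓ] (Set.range (tateModuleMap ℓ : (A ⟶ B) → _)) := by
  classical
  obtain ⟨T, hT⟩ := exists_addMonoidHom_tateModuleMap (A := A) (B := B) ℓ
  obtain ⟨c, hc⟩ := (Finsupp.mem_span_range_iff_exists_finsupp).mp hs
  -- `c f = zmodRepr (c f) + ℓ * q f`
  have hq : ∀ f : A ⟶ B, ∃ q : ℤ_[ℓ], c f = (PadicInt.zmodRepr (c f) : ℤ_[ℓ]) + (ℓ : ℤ_[ℓ]) * q := by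
    intro f
    have h := PadicInt.sub_zmodRepr_mem (c f)
    rw [PadicInt.maximalIdeal_eq_span_p, Ideal.mem_span_singleton'] at h
    obtain ⟨q, hq⟩ := h
    exact ⟨q, by rw [mul_comm, hq, add_sub_cancel]⟩
  choose q hq using hq
  -- the integral part `φ = Σ nᵢ fᵢ` and the rest `r = s - Σ qᵢ T fᵢ`
  set φ : A ⟶ B := c.sum fun f _ ↦ PadicInt.zmodRepr (c f) • f with hφ
  set r : A.tateModule ℓ →ₗ[ℤ_[ℓ]] B.tateModule ℓ := s - c.sum fun f _ ↦ q f • tateModuleMap ℓ f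
    with hr
  have hTφ : tateModuleMap ℓ φ = (ℓ : ℤ_[ℓ]) • r := by
    have h1 : tateModuleMap ℓ φ = c.sum fun f _ ↦ PadicInt.zmodRepr (c f) • tateModuleMap ℓ f := by
      rw [hφ, ← hT, map_finsuppSum]
      refine Finsupp.sum_congr fun f _ ↦ ?_
      rw [map_nsmul, hT]
    have h2 : (ℓ : ℤ_[ℓ]) • s = (c.sum fun f _ ↦ PadicInt.zmodRepr (c f) • tateModuleMap ℓ f) +
        (ℓ : ℤ_[ℓ]) • c.sum fun f _ ↦ q f • tateModuleMap ℓ f := by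
      rw [← hc, Finsupp.smul_sum, ← Finsupp.sum_add]
      refine Finsupp.sum_congr fun f _ ↦ ?_
      rw [← Nat.cast_smul_eq_nsmul ℤ_[ℓ], ← mul_smul, ← add_smul, ← hq f]
    rw [h1, hr, smul_sub, h2, add_sub_cancel_right]
  -- `φ` kills `A[ℓ](K̄)`
  have hkill : ∀ x : A.geomPoints, ℓ • x = 0 → Hom.geomPointsMap φ x = 0 := by
    intro x hx
    obtain ⟨a, rfl⟩ := hproj x hx
    rw [← proj_tateModuleMap, hTφ, LinearMap.smul_apply, Nat.cast_smul_eq_nsmul, map_nsmul]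
    simpa only [pow_one] using TateModule.pow_smul_proj 1 (r a)
  obtain ⟨ψ, hψ⟩ := hdiv φ hkill
  -- `r = T ψ`
  have hrψ : r = tateModuleMap ℓ ψ := by
    have h : (ℓ : ℤ_[ℓ]) • r = (ℓ : ℤ_[ℓ]) • tateModuleMap ℓ ψ := by
      rw [← hTφ, hψ, tateModuleMap_nsmul, Nat.cast_smul_eq_nsmul]
    exact smul_right_injective _ (by exact_mod_cast (Fact.out : ℓ.Prime).ne_zero) h
  have hs' : s = tateModuleMap ℓ ψ + c.sum fun f _ ↦ q f • tateModuleMap ℓ f := by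
    rw [← hrψ, hr, sub_add_cancel]
  rw [hs']
  refine Submodule.add_mem _ (Submodule.subset_span ⟨ψ, rfl⟩) ?_
  exact Submodule.sum_mem _ fun f _ ↦ Submodule.smul_mem _ _ (Submodule.subset_span ⟨f, rfl⟩)

/-- From `ℓ`-saturation to saturation with respect to every non-zero `d ∈ ℤ_ℓ`
(`d = u ℓᵐ` with `u` a unit, `PadicInt.unitCoeff_spec`; induction on `m`). [folklore] -/
theorem mem_span_of_smul_mem_span_of_forall
    {N : Submodule ℤ_[ℓ] (A.tateModule ℓ →ₗ[ℤ_[ℓ]] B.tateModule ℓ)}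
    (hN : ∀ s, (ℓ : ℤ_[ℓ]) • s ∈ N → s ∈ N) {t : A.tateModule ℓ →ₗ[ℤ_[ℓ]] B.tateModule ℓ}
    {d : ℤ_[ℓ]} (hd : d ≠ 0) (ht : d • t ∈ N) : t ∈ N := by
  have hpow : ∀ (m : ℕ) (s : A.tateModule ℓ →ₗ[ℤ_[ℓ]] B.tateModule ℓ),
      (ℓ : ℤ_[ℓ]) ^ m • s ∈ N → s ∈ N := by
    intro m
    induction m with
    | zero => intro s hs; rwa [pow_zero, one_smul] at hs
    | succ m ih =>
      intro s hs
      rw [pow_succ', mul_smul] at hs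
      exact ih s (hN _ hs)
  obtain ⟨u, m, hdu⟩ : ∃ (u : ℤ_[ℓ]ˣ) (m : ℕ), d = u * (ℓ : ℤ_[ℓ]) ^ m :=
    ⟨_, _, PadicInt.unitCoeff_spec hd⟩
  rw [hdu] at ht
  have h := N.smul_mem (↑u⁻¹ : ℤ_[ℓ]) ht
  rw [smul_smul, ← mul_assoc, Units.inv_mul, one_mul] at h
  exact hpow m t h

/-- **Torsion-free cokernel from divisibility** (Tate 1966, §1 Lemma 1; Milne 1986 Thm. 12.5;
Kieffer 2024 Prop. 1.2.21): for `ℓ ≠ char K`, if every `φ : A → B` killing `A[ℓ](K̄)` is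
divisible by `ℓ` in `Hom_K(A, B)` (isogeny factorisation through the separable isogeny `[ℓ]_A`,
Kieffer Prop. 1.1.12; Mumford §7 Thm. 4), then the `ℤ_ℓ`-span of the `T_ℓ f` is saturated in
`Hom_{ℤ_ℓ}(T_ℓ A, T_ℓ B)` — the hypothesis `hsat` of `tate_bijective_of_finite_of_open_facts`.
[cite: Kieffer2024IsogenyGraphs, Prop. 1.2.21] -/
theorem saturated_span_tateModuleMap_of_divisible (hℓ : (ℓ : K) ≠ 0)
    (hdiv : ∀ φ : A ⟶ B, (∀ x : A.geomPoints, ℓ • x = 0 → Hom.geomPointsMap φ x = 0) →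
      ∃ ψ : A ⟶ B, φ = ℓ • ψ)
    (t : A.tateModule ℓ →ₗ[ℤ_[ℓ]] B.tateModule ℓ) (d : ℤ_[ℓ]) (hd : d ≠ 0)
    (ht : d • t ∈ Submodule.span ℤ_[ℓ] (Set.range (tateModuleMap ℓ : (A ⟶ B) → _))) :
    t ∈ Submodule.span ℤ_[ℓ] (Set.range (tateModuleMap ℓ : (A ⟶ B) → _)) :=
  mem_span_of_smul_mem_span_of_forall ℓ
    (fun _ hs ↦ mem_span_of_smul_mem_span_of_divisible ℓ
      (exists_proj_one_eq_of_cast_ne_zero ℓ hℓ) hdiv hs) hd ht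

variable (A B)

/-- **Tate's Main Theorem from the open named facts, divisibility form.** As
`tate_bijective_of_finite_of_open_facts`, with the saturation hypothesis replaced by divisibility
by `ℓ` in `Hom_K(A, B)` of homomorphisms killing `A[ℓ](K̄)` (`hdiv`: isogeny factorisation
through `[ℓ]_A`, Kieffer 2024 Prop. 1.1.12 with Prop. 1.2.21; Mumford §7 Thm. 4), via
`saturated_span_tateModuleMap_of_divisible`. The remaining inputs are the named facts
`faltingsTateMap_injective A B`, `finite_isoClasses_of_finite K g`, `exists_quotient_isogeny P ℓ`
and the semisimplicity of `E_ℓ(P)`. [cite: Tate1966Endomorphisms, Main Theorem] -/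
theorem tate_bijective_of_finite_of_open_facts_of_divisible (hinj : faltingsTateMap_injective A B)
    (hfin : ∀ g : ℕ, finite_isoClasses_of_finite K g)
    (hq : ∀ P : AbelianVariety K, exists_quotient_isogeny P ℓ)
    (hss : ∀ P : AbelianVariety K, IsSemisimpleRing (rationalEndSubalgebra P ℓ))
    (hdiv : (ℓ : K) ≠ 0 → ∀ φ : A ⟶ B,
      (∀ x : A.geomPoints, ℓ • x = 0 → Hom.geomPointsMap φ x = 0) → ∃ ψ : A ⟶ B, φ = ℓ • ψ) :
    tate_bijective_of_finite A B ℓ :=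
  tate_bijective_of_finite_of_open_facts A B ℓ hinj hfin hq hss fun hℓ t d hd ht ↦
    saturated_span_tateModuleMap_of_divisible ℓ hℓ (hdiv hℓ) t d hd ht

end Saturation

end Literature.AlgebraicGeometry.Motives
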